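import Summits.Ventures.CertifiedManyBodySolver.Downfold.PinnedVertexTwoCoupling
import Summits.Ventures.CertifiedManyBodySolver.Downfold.TPrimePinnedPairRowKernelWide
import Summits.Ventures.CertifiedManyBodySolver.Rows.DopedTLCorrPinnedPairU
import HarnessLib

/-!
# The PINNED U-PAIR shape FROM TWO WINDOW IDENTITIES / two semantic kernel residuals on a window `Λ' ⊇ Λ₇ = box 2 7`:
# `SquareTTPrimePinnedPairRowU.of_windowIdentities_wide`, `…of_residPolys_wide` (cell `pub/hubbard-obs`, D-0154 (1)(C) COVERAGE
# Hg-1201; seat `hubbard-cov-hg1201-box-2`, typist / lineage desk; zero compute)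

HONEST FRAMING: soundness PLUMBING between objects already in the tree, the U-AXIS twin of hubbard-cov-la214-unc-2's t′-pair link
(`Downfold/TPrimePinnedPairRowKernel.lean` p665976, `…KernelWide.lean` p678325). The state-level PINNED U-PAIR SHAPE
`SquareTTPrimePinnedPairRowU UA UB s cA cB flA flB βA κA κA' slA βB κB κB' slB n₀ S Λ X` (hubbard-cov-hg1201-box-1, `Rows/DopedTLCorrPinnedPairU.lean`
p660744) is what the two `certsdp-cert/0` certificates of a pinned U-pair {A at `U = UA`, B at `U = UB`} (same `t′ = s`, same objective `X`, solved at
density `n₀`, SHARED equation-of-motion multipliers) establish at the level of states; its `.bundleWND_interior / _vertex` turn every Hg-1201 PAIR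
sibling (p660947 / p660953 M19b, p671545 / p671559 M19, p671532 / p677531 @10) into the U-cell WND claim node of record. Until now the U-pair shape had
NO link to window identities: the two-coupling core `pinnedVertexRow₂_of_windowIdentity` / `pinnedStationarity₂` (`Downfold/PinnedVertexTwoCoupling.lean`,
p669140) was written for exactly this twin («instantiate `sv := s` — the `K₂` terms carry the factor `(s − s) = 0` — and take `E₀ := E₀₀ + s·E₁`, `E₁ := E₂`»,
hubbard-obs STATUS 2026-08-28T21:01:30Z; captain hubbard-cov-hg1201-plan-1 WORD 21:07:30Z (4): idle-time plumbing after the M19 / @10 close-outs).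
THIS FILE IS THAT PASSAGE. Nothing is asserted: no `def`, no named fact, no `sorry`, no number; no claim node is discharged (that needs an exporter of
the two Hg vertex certificates to the residual data shape + the kernel evaluation of two inequalities — «tier P», kit-side); CONTROL / CALIBRATION
wording class (xx1); no node of record, tier, hold, word or registry row changes; no summit statement is proved by this file.

* §1 **`SquareTTPrimePinnedPairRowU.of_windowIdentities_wide`**: two window identities in `𝔄_{Λ'}` (ANY `Λ' ⊇ box 2 7`, the exporter's outer table)
  in the tree's `hcert` shape, ISSUED AT `(1, s, UA)` and `(1, s, UB)` — objective `Γ(incl h7) X` (the SAME word at both vertices), constant `c_v`,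
  density rows `(μ_v, ν_v)`, a CAP row `κ_v (cap_v·1 − ΓE_Φ^{(1,s,U_v)})`, a CUT row `κ_v′ (ΓE_Φ^{(1,s,U_v)} − fl_v·1)`, Gram data, the eom family
  `Σ_{k∈se} [H^{(1,s,U_v)}_{Λ'}, ΓB_k]` on ONE SHARED word list `B_k`, affine-`D₄` / charged / anti-Hermitian / residual families — give
  `SquareTTPrimePinnedPairRowU UA UB s capA capB flA flB βA κA κA' slA βB κB κB' slB n₀ univ (box 2 7) X` for all rational
  `β_v ≤ c_v − Σ‖a_v‖ + (Σ_σ μ_vσ)(n₀/2 − ν_v)` and `2·sl_v = Σ_σ μ_vσ`. The U-shape quantifies over EVERY density `x ∈ [0, 2)` with the affine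
  term `sl_v·(x − n₀)`: that term IS the identity's own expect-row value `(Σμ_v)(x/2 − ν_v)` re-centred at `n₀` (no transport, no extra premise).
  PROOF: witnesses `E₀ω = E₀₀ω + s·E₁ω`, `E₁ω = E₂ω` (orbit means of `Σ_k[H^{(1,0,0)}_{Λ'}, ΓB_k]`, `Σ_k[T′_{Λ'}, ΓB_k]`, `Σ_k[D_{Λ'}, ΓB_k]`);
  (E) = `pinnedStationarity₂`; (V_A)/(V_B) = `pinnedVertexRow₂_of_windowIdentity` with `sv := s`, `Uv := U_v` (the `K₂` terms vanish), the
  `box 2 7` orbit mean recovered by `expect_d4Emb_fermionEmbed_incl` (p678325);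
* §2 **`SquareTTPrimePinnedPairRowU.of_residPolys_wide`**: the same from two SEMANTIC kernel residuals (hubbard-obs-p2's
  `CARPolyWindow.windowIdentity_of_residPoly`, rational data, `lowerConst` prices) — the consumer interface every staged kernel edition (merge
  chain / hinted quotient / adjoint / near) feeds through its `hR_v`, exactly as for the t′-pairs.

EFFECT (by name, nothing new asserted): kernel residual data for the two vertices of an Hg-1201 U-cell ⇒ (§2) the PAIR sibling ⇒ (box-1's
`…_wnd_of_pair`) the WND node of record ⇒ (the landed closers) the item / rung leaf. WHAT A USER STILL OWES per cell: the exporter's term lists and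
dictionaries, the geometric side conditions, and the evaluation of the two inequalities (tier P3) — none of which exists for Hg today.

References: D. P. Bertsekas, *Nonlinear Programming*, 2nd ed. (1999), Prop. 5.1.3 [Bertsekas1999NonlinearProgramming]; S. Boyd, L. Vandenberghe,
*Convex Optimization* (2004) §5.9 [BoydVandenberghe2004]; J. Wang et al., PRX 14 (2024) 031006 §III [WangEtAl2024]; X. Han, arXiv:2006.06002 §3
[Han2020Bootstrap]; T. Koma, H. Tasaki, J. Stat. Phys. 76 (1994) 745 §1 [KomaTasaki1994]; C. Jansson, D. Chaykin, C. Keil, SIAM J. Numer. Anal. 46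
(2008) 180 [JanssonChaykinKeil2008]; H. Araki, H. Moriya, Rev. Math. Phys. 15 (2003) 93 §4.1 [ArakiMoriya2003].
-/

noncomputable section

namespace Summit.Ventures.CertifiedManyBodySolver.Downfold

open Literature.MathematicalPhysics.QuantumLattice
open Matrix HubbardWave0 Literature.Probability.LatticeModels ThermodynamicLimit Filter Topology
open Literature.MathematicalPhysics.QuantumManyBody.StateRelaxation
open Summit.Ventures.CertifiedQuantumChemistry Summit.Ventures.CertifiedQuantumChemistry.CARPoly
open Summit.Ventures.CertifiedManyBodySolver.CARPolyWindow
open scoped BigOperators ComplexOrder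

/-! ## §1 Two window identities at `(1, s, UA)`, `(1, s, UB)` on `Λ' ⊇ Λ₇` with ONE shared eom word list ⇒ the pinned U-pair shape -/

section PairWide

/-- The density term of the U-shape is the identity's expect-row value re-centred at `n₀`:
`sl·(x − n₀) = (Σμ)(x/2 − ν) − (Σμ)(n₀/2 − ν)` when `2·sl = Σμ`. [folklore] -/
theorem slope_recentre {sl S ν n₀ x : ℝ} (h : 2 * sl = S) :
    sl * (x - n₀) = S * (x / 2 - ν) - S * (n₀ / 2 - ν) := by
  linear_combination ((x - n₀) / 2) * h

/-- **PINNED U-PAIR SHAPE FROM TWO WINDOW IDENTITIES ON A WINDOW `Λ' ⊇ Λ₇`.** Square lattice, `t = 1`, fixed `t′ = s`, couplings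
`0 ≤ UA`, `UB`; window `Λ ⊆ Λ'` with `thicken Λ 1 ⊆ Λ'`, `box 2 7 ⊆ Λ'`; ONE objective word `X ∈ 𝔄_{box 2 7}` read as `Γ(incl h7) X`; SHARED
equation-of-motion words `B_k ∈ 𝔄_Λ` (`k ∈ se`). For each vertex `v ∈ {A, B}` ONE window identity in `𝔄_{Λ'}` in the tree's `hcert` shape ISSUED AT
`(1, s, U_v)` with constant `c_v`, density rows `(μ_v, ν_v)`, a cap row `κ_v (cap_v·1 − ΓE_Φ^{(1,s,U_v)})`, a cut row `κ_v′ (ΓE_Φ^{(1,s,U_v)} − fl_v·1)`,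
Gram data `(Λm_v ⪰ 0, O_v)`, the eom family `Σ_{k∈se} [H^{(1,s,U_v)}_{Λ'}, ΓB_k]` ON THE SHARED WORDS, affine-`D₄` / charged / anti-Hermitian /
residual families. Then for all rational `β_v ≤ c_v − Σ‖a_v‖ + (Σ_σ μ_vσ)(n₀/2 − ν_v)` and slopes `2·sl_v = Σ_σ μ_vσ`:
`SquareTTPrimePinnedPairRowU UA UB s capA capB flA flB βA κA κA′ slA βB κB κB′ slB n₀ univ (box 2 7) X` — with the witnesses
`E₀ω = |D₄|⁻¹Σ_γ Re (ω∘γ)(Σ_k [H^{(1,0,0)}_{Λ'}, ΓB_k]) + s·|D₄|⁻¹Σ_γ Re (ω∘γ)(Σ_k [T′_{Λ'}, ΓB_k])`, `E₁ω = |D₄|⁻¹Σ_γ Re (ω∘γ)(Σ_k [D_{Λ'}, ΓB_k])`: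
(E) is `pinnedStationarity₂`, (V_A)/(V_B) are `pinnedVertexRow₂_of_windowIdentity` at `sv := s` (no `K₂` term survives). No sign condition on the
`κ`'s is needed for the shape itself (the docc-box law `…bundleWND` asks for them downstream).
[cite: Bertsekas1999NonlinearProgramming, Prop. 5.1.3] [cite: BoydVandenberghe2004, §5.9] [cite: WangEtAl2024, §III] -/
theorem SquareTTPrimePinnedPairRowU.of_windowIdentities_wide
    {UA : ℝ} (hUA : 0 ≤ UA) (UB s : ℝ) (n₀ : ℚ)
    {Λ Λ' : Finset (Site 2)} (h7 : box 2 7 ⊆ Λ') (hΛ : Λ ⊆ Λ') (h8 : thicken Λ 1 ⊆ Λ')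
    (h0 : thicken ({0} : Finset (Site 2)) 1 ⊆ Λ') (hz : (0 : Site 2) ∈ Λ')
    (X : FermionOp (box 2 7))
    {κι : Type*} (se : Finset κι) (B : κι → FermionOp Λ)
    -- vertex A (issued at `U = UA`)
    (μA : Fin 2 → ℝ) (νA : ℝ) (capA flA κA κA' : ℚ)
    {mA : Type*} [Fintype mA] [DecidableEq mA] {ΛmA : Matrix mA mA ℂ} (hΛmA : ΛmA.PosSemidef) (OA : mA → FermionOp Λ')
    {ιA : Type*} (ttA : Finset ιA) (γA : ιA → DihedralGroup 4) (wvA : ιA → Site 2) (hshA : ∀ l, d4ShiftSet (γA l) (wvA l) Λ ⊆ Λ')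
    (YA : ιA → FermionOp Λ)
    {ρA : Type*} (uuA : Finset ρA) (bA : ρA → ℂ) (cwA : ρA → List (Orb (PolySite Λ') × Bool))
    (hcwA : ∀ j ∈ uuA, ladderCharge (cwA j) ≠ 0 ∨ ladderSpinCharge (cwA j) ≠ 0)
    {δA : Type*} (ahA : Finset δA) (dcA : δA → ℝ) (VA : δA → FermionOp Λ')
    {κ''A : Type*} (wA : Finset κ''A) (aA : κ''A → ℂ) (wordA : κ''A → List (Orb (PolySite Λ') × Bool))
    {cA0 : ℝ}
    (hcertA : fermionEmbed (PolySite.incl h7) X - (cA0 : ℂ) • (1 : FermionOp Λ') -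
        ∑ σ : Fin 2, ((μA σ : ℝ) : ℂ) • (nAt 0 hz σ - ((νA : ℝ) : ℂ) • (1 : FermionOp Λ')) -
        (((κA : ℚ) : ℝ) : ℂ) • ((((capA : ℚ) : ℝ) : ℂ) • (1 : FermionOp Λ') -
          fermionEmbed (PolySite.incl h0) ((hubbardTTPrimeFermionInteraction 1 s UA).meanEnergyObs 1)) -
        (((κA' : ℚ) : ℝ) : ℂ) • (fermionEmbed (PolySite.incl h0) ((hubbardTTPrimeFermionInteraction 1 s UA).meanEnergyObs 1) -
          (((flA : ℚ) : ℝ) : ℂ) • (1 : FermionOp Λ')) =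
      gramForm ΛmA OA +
        (∑ k ∈ se, ((hubbardTTPrimeFermionInteraction 1 s UA).localHamiltonian Λ' * fermionEmbed (PolySite.incl hΛ) (B k) -
            fermionEmbed (PolySite.incl hΛ) (B k) * (hubbardTTPrimeFermionInteraction 1 s UA).localHamiltonian Λ') +
          ∑ l ∈ ttA, (fermionEmbed (PolySite.incl (hshA l)) (fermionEmbed (PolySite.d4Emb (γA l) (wvA l) Λ) (YA l)) -
            fermionEmbed (PolySite.incl hΛ) (YA l)) +
          ∑ j ∈ uuA, bA j • ladderWord (cwA j)) +
        (∑ m' ∈ ahA, ((dcA m' : ℝ) : ℂ) • ((VA m')ᴴ - VA m') + ∑ k ∈ wA, aA k • ladderWord (wordA k)))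
    {βA slA : ℚ} (hβA : ((βA : ℚ) : ℝ) ≤ cA0 - ∑ k ∈ wA, ‖aA k‖ + (∑ σ : Fin 2, μA σ) * (((n₀ : ℚ) : ℝ) / 2 - νA))
    (hslA : 2 * ((slA : ℚ) : ℝ) = ∑ σ : Fin 2, μA σ)
    -- vertex B (issued at `U = UB`)
    (μB : Fin 2 → ℝ) (νB : ℝ) (capB flB κB κB' : ℚ)
    {mB : Type*} [Fintype mB] [DecidableEq mB] {ΛmB : Matrix mB mB ℂ} (hΛmB : ΛmB.PosSemidef) (OB : mB → FermionOp Λ')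
    {ιB : Type*} (ttB : Finset ιB) (γB : ιB → DihedralGroup 4) (wvB : ιB → Site 2) (hshB : ∀ l, d4ShiftSet (γB l) (wvB l) Λ ⊆ Λ')
    (YB : ιB → FermionOp Λ)
    {ρB : Type*} (uuB : Finset ρB) (bB : ρB → ℂ) (cwB : ρB → List (Orb (PolySite Λ') × Bool))
    (hcwB : ∀ j ∈ uuB, ladderCharge (cwB j) ≠ 0 ∨ ladderSpinCharge (cwB j) ≠ 0)
    {δB : Type*} (ahB : Finset δB) (dcB : δB → ℝ) (VB : δB → FermionOp Λ')
    {κ''B : Type*} (wB : Finset κ''B) (aB : κ''B → ℂ) (wordB : κ''B → List (Orb (PolySite Λ') × Bool))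
    {cB0 : ℝ}
    (hcertB : fermionEmbed (PolySite.incl h7) X - (cB0 : ℂ) • (1 : FermionOp Λ') -
        ∑ σ : Fin 2, ((μB σ : ℝ) : ℂ) • (nAt 0 hz σ - ((νB : ℝ) : ℂ) • (1 : FermionOp Λ')) -
        (((κB : ℚ) : ℝ) : ℂ) • ((((capB : ℚ) : ℝ) : ℂ) • (1 : FermionOp Λ') -
          fermionEmbed (PolySite.incl h0) ((hubbardTTPrimeFermionInteraction 1 s UB).meanEnergyObs 1)) -
        (((κB' : ℚ) : ℝ) : ℂ) • (fermionEmbed (PolySite.incl h0) ((hubbardTTPrimeFermionInteraction 1 s UB).meanEnergyObs 1) -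
          (((flB : ℚ) : ℝ) : ℂ) • (1 : FermionOp Λ')) =
      gramForm ΛmB OB +
        (∑ k ∈ se, ((hubbardTTPrimeFermionInteraction 1 s UB).localHamiltonian Λ' * fermionEmbed (PolySite.incl hΛ) (B k) -
            fermionEmbed (PolySite.incl hΛ) (B k) * (hubbardTTPrimeFermionInteraction 1 s UB).localHamiltonian Λ') +
          ∑ l ∈ ttB, (fermionEmbed (PolySite.incl (hshB l)) (fermionEmbed (PolySite.d4Emb (γB l) (wvB l) Λ) (YB l)) -
            fermionEmbed (PolySite.incl hΛ) (YB l)) +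
          ∑ j ∈ uuB, bB j • ladderWord (cwB j)) +
        (∑ m' ∈ ahB, ((dcB m' : ℝ) : ℂ) • ((VB m')ᴴ - VB m') + ∑ k ∈ wB, aB k • ladderWord (wordB k)))
    {βB slB : ℚ} (hβB : ((βB : ℚ) : ℝ) ≤ cB0 - ∑ k ∈ wB, ‖aB k‖ + (∑ σ : Fin 2, μB σ) * (((n₀ : ℚ) : ℝ) / 2 - νB))
    (hslB : 2 * ((slB : ℚ) : ℝ) = ∑ σ : Fin 2, μB σ) :
    SquareTTPrimePinnedPairRowU UA UB s capA capB flA flB βA κA κA' slA βB κB κB' slB n₀ Finset.univ (box 2 7) X := by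
  have h1 : (1 : DihedralGroup 4) ∈ (Finset.univ : Finset (DihedralGroup 4)) := Finset.mem_univ _
  have hmul : ∀ a ∈ (Finset.univ : Finset (DihedralGroup 4)), ∀ b ∈ (Finset.univ : Finset (DihedralGroup 4)),
      a * b ∈ (Finset.univ : Finset (DihedralGroup 4)) := fun _ _ _ _ => Finset.mem_univ _
  refine ⟨fun ω => ((Finset.univ : Finset (DihedralGroup 4)).card : ℝ)⁻¹ * ∑ g ∈ (Finset.univ : Finset (DihedralGroup 4)),
        (ω.expect (d4ShiftSet g 0 Λ') (fermionEmbed (PolySite.d4Emb g 0 Λ')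
          (∑ k ∈ se, ((hubbardTTPrimeFermionInteraction 1 0 0).localHamiltonian Λ' * fermionEmbed (PolySite.incl hΛ) (B k) -
            fermionEmbed (PolySite.incl hΛ) (B k) * (hubbardTTPrimeFermionInteraction 1 0 0).localHamiltonian Λ')))).re +
      s * (((Finset.univ : Finset (DihedralGroup 4)).card : ℝ)⁻¹ * ∑ g ∈ (Finset.univ : Finset (DihedralGroup 4)),
        (ω.expect (d4ShiftSet g 0 Λ') (fermionEmbed (PolySite.d4Emb g 0 Λ')
          (∑ k ∈ se, ((hubbardTTPrimeFermionInteraction 0 1 0).localHamiltonian Λ' * fermionEmbed (PolySite.incl hΛ) (B k) -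
            fermionEmbed (PolySite.incl hΛ) (B k) * (hubbardTTPrimeFermionInteraction 0 1 0).localHamiltonian Λ')))).re),
    fun ω => ((Finset.univ : Finset (DihedralGroup 4)).card : ℝ)⁻¹ * ∑ g ∈ (Finset.univ : Finset (DihedralGroup 4)),
      (ω.expect (d4ShiftSet g 0 Λ') (fermionEmbed (PolySite.d4Emb g 0 Λ')
          (∑ k ∈ se, ((hubbardTTPrimeFermionInteraction 0 0 1).localHamiltonian Λ' * fermionEmbed (PolySite.incl hΛ) (B k) -
            fermionEmbed (PolySite.incl hΛ) (B k) * (hubbardTTPrimeFermionInteraction 0 0 1).localHamiltonian Λ')))).re,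
    fun U hU x hx0 hx2 ω Ls ψ hLs hψ hψ1 hω => ⟨?_, ?_, ?_⟩⟩
  · have h := pinnedStationarity₂ (hUA.trans hU.1) hx0 hx2 s hΛ h8 h0 hz h1 hmul se B hLs hψ hψ1 hω
    linarith
  · have h := pinnedVertexRow₂_of_windowIdentity (hUA.trans hU.1) hx0 hx2 s UA s hΛ h8 h0 hz h1 hmul
      (fermionEmbed (PolySite.incl h7) X) μA νA capA flA κA κA' hΛmA OA se B ttA γA (fun l _ => Finset.mem_univ _) wvA hshA YA
      uuA bA cwA hcwA ahA dcA VA wA aA wordA hcertA hLs hψ hψ1 hω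
    simp_rw [expect_d4Emb_fermionEmbed_incl ω h7] at h
    simp only [sub_self, zero_mul, add_zero, sub_zero] at h
    have key := slope_recentre (ν := νA) (n₀ := ((n₀ : ℚ) : ℝ)) (x := x) hslA
    linarith
  · have h := pinnedVertexRow₂_of_windowIdentity (hUA.trans hU.1) hx0 hx2 s UB s hΛ h8 h0 hz h1 hmul
      (fermionEmbed (PolySite.incl h7) X) μB νB capB flB κB κB' hΛmB OB se B ttB γB (fun l _ => Finset.mem_univ _) wvB hshB YB
      uuB bB cwB hcwB ahB dcB VB wB aB wordB hcertB hLs hψ hψ1 hω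
    simp_rw [expect_d4Emb_fermionEmbed_incl ω h7] at h
    simp only [sub_self, zero_mul, add_zero, sub_zero] at h
    have key := slope_recentre (ν := νB) (n₀ := ((n₀ : ℚ) : ℝ)) (x := x) hslB
    linarith

end PairWide

/-! ## §2 Two semantic kernel residuals on `Λ' ⊇ Λ₇` with ONE shared eom word list ⇒ the pinned U-pair shape -/

section PolyWide

variable {α β : Type*}

/-- **KERNEL FORM OF THE U-PAIR SHAPE, SEMANTIC RESIDUALS, ON A WINDOW `Λ' ⊇ Λ₇`.** Square lattice, `t = 1`, rational `0 ≤ UA`, `UB`, `s`,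
anchor density `n₀`; letters `d : α → Orb (PolySite Λ')` (inner letters `dΛ`/`f`, origin letters `o`); ONE objective word `X ∈ 𝔄_{box 2 7}`; ONE
SHARED eom word list `EB`. For each vertex `v ∈ {A, B}`: dictionaries `TH_v ↦ H^{(1,s,U_v)}_{Λ'}`, `TE_v ↦ ΓE^{(1,s,U_v)}`, an objective term list
`TX_v` with `termOp d TX_v = Γ(incl h7) X`, density multipliers `μ_v`, slot `ν_v`, cap row `(κ_v, cap_v)`, cut row `(κ_v′, fl_v)`, an abstract
Gram term `TG_v` (`termOp d TG_v = gramForm Λm_v O_v`, `Λm_v ⪰ 0`), moves `(γ_v, wv_v, g_v)` on inner words `SY_v`, charged words `CW_v`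
(charges decided on the syntax), anti-Hermitian parts `AV_v`, ANY polynomial `R_v` denoting the residual (`evalPoly d R_v = termOp d (residTG …)` —
a collected normal form or the decoded end of a staged merge chain), ONE rational inequality `β_v ≤ lowerConst R_v + (μ_v 0 + μ_v 1)(n₀/2 − ν_v)`
and the slope identity `μ_v 0 + μ_v 1 = 2·sl_v` (both decidable). THEN
`SquareTTPrimePinnedPairRowU UA UB s capA capB flA flB βA κA κA′ slA βB κB κB′ slB n₀ univ (box 2 7) X`.
[cite: WangEtAl2024, §III] [cite: JanssonChaykinKeil2008, §3] [cite: Bertsekas1999NonlinearProgramming, Prop. 5.1.3] -/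
theorem SquareTTPrimePinnedPairRowU.of_residPolys_wide
    (UA : ℚ) (hUA : 0 ≤ UA) (UB s n₀ : ℚ)
    {Λ Λ' : Finset (Site 2)} (h7 : box 2 7 ⊆ Λ') (hΛ : Λ ⊆ Λ') (h8 : thicken Λ 1 ⊆ Λ')
    (h0 : thicken ({0} : Finset (Site 2)) 1 ⊆ Λ') (hz : (0 : Site 2) ∈ Λ')
    -- letters (shared)
    (d : α → Orb (PolySite Λ'))
    (dΛ : β → Orb (PolySite Λ)) (f : β → α) (hf : ∀ b, d (f b) = Orb.embMap (PolySite.incl hΛ) (dΛ b))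
    (sp : α → Fin 2) (hsp : ∀ a, (ofLex (d a)).2 = sp a)
    (o : Fin 2 → α) (ho : ∀ σ, d (o σ) = orb (PolySite.pt 0 hz) σ)
    -- the objective word and the SHARED eom words
    (X : FermionOp (box 2 7)) (EB : List (Terms β))
    -- vertex A (issued at `U = UA`)
    (THA : Terms α) (hHA : termOp d THA = (hubbardTTPrimeFermionInteraction 1 (s : ℝ) (UA : ℝ)).localHamiltonian Λ')
    (TEA : Terms α)
    (hEA : termOp d TEA = fermionEmbed (PolySite.incl h0) ((hubbardTTPrimeFermionInteraction 1 (s : ℝ) (UA : ℝ)).meanEnergyObs 1))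
    (TXA : Terms α) (hXA : termOp d TXA = fermionEmbed (PolySite.incl h7) X) (μA : Fin 2 → ℚ) (νA κA capA κA' flA : ℚ)
    (TGA : Terms α) {mA : Type*} [Fintype mA] [DecidableEq mA] {ΛmA : Matrix mA mA ℂ} (hΛmA : ΛmA.PosSemidef)
    (OA : mA → FermionOp Λ') (hGA : termOp d TGA = gramForm ΛmA OA)
    {nSA : ℕ} (γA : Fin nSA → DihedralGroup 4) (wvA : Fin nSA → Site 2) (hshA : ∀ l, d4ShiftSet (γA l) (wvA l) Λ ⊆ Λ')
    (gA : Fin nSA → β → α)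
    (hgA : ∀ l b, d (gA l b) = Orb.embMap (PolySite.incl (hshA l)) (Orb.embMap (PolySite.d4Emb (γA l) (wvA l) Λ) (dΛ b)))
    (SYA : Fin nSA → Terms β) (CWA : Terms α) (hcwA : ∀ wc ∈ CWA, chargeW wc.1 ≠ 0 ∨ spinChargeW sp wc.1 ≠ 0) (AVA : List (Terms α))
    {RA : CARPoly.Poly α}
    (hRA : evalPoly d RA = termOp d (residTG TXA μA νA o κA capA κA' flA TEA TGA THA f EB gA SYA CWA AVA))
    {βA slA : ℚ} (hβA : βA ≤ lowerConst RA + (μA 0 + μA 1) * (n₀ / 2 - νA)) (hslA : μA 0 + μA 1 = 2 * slA)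
    -- vertex B (issued at `U = UB`)
    (THB : Terms α) (hHB : termOp d THB = (hubbardTTPrimeFermionInteraction 1 (s : ℝ) (UB : ℝ)).localHamiltonian Λ')
    (TEB : Terms α)
    (hEB : termOp d TEB = fermionEmbed (PolySite.incl h0) ((hubbardTTPrimeFermionInteraction 1 (s : ℝ) (UB : ℝ)).meanEnergyObs 1))
    (TXB : Terms α) (hXB : termOp d TXB = fermionEmbed (PolySite.incl h7) X) (μB : Fin 2 → ℚ) (νB κB capB κB' flB : ℚ)
    (TGB : Terms α) {mB : Type*} [Fintype mB] [DecidableEq mB] {ΛmB : Matrix mB mB ℂ} (hΛmB : ΛmB.PosSemidef)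
    (OB : mB → FermionOp Λ') (hGB : termOp d TGB = gramForm ΛmB OB)
    {nSB : ℕ} (γB : Fin nSB → DihedralGroup 4) (wvB : Fin nSB → Site 2) (hshB : ∀ l, d4ShiftSet (γB l) (wvB l) Λ ⊆ Λ')
    (gB : Fin nSB → β → α)
    (hgB : ∀ l b, d (gB l b) = Orb.embMap (PolySite.incl (hshB l)) (Orb.embMap (PolySite.d4Emb (γB l) (wvB l) Λ) (dΛ b)))
    (SYB : Fin nSB → Terms β) (CWB : Terms α) (hcwB : ∀ wc ∈ CWB, chargeW wc.1 ≠ 0 ∨ spinChargeW sp wc.1 ≠ 0) (AVB : List (Terms α))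
    {RB : CARPoly.Poly α}
    (hRB : evalPoly d RB = termOp d (residTG TXB μB νB o κB capB κB' flB TEB TGB THB f EB gB SYB CWB AVB))
    {βB slB : ℚ} (hβB : βB ≤ lowerConst RB + (μB 0 + μB 1) * (n₀ / 2 - νB)) (hslB : μB 0 + μB 1 = 2 * slB) :
    SquareTTPrimePinnedPairRowU (UA : ℝ) (UB : ℝ) (s : ℝ) capA capB flA flB βA κA κA' slA βB κB κB' slB n₀
      Finset.univ (box 2 7) X := by
  have hUr : (0 : ℝ) ≤ ((UA : ℚ) : ℝ) := by exact_mod_cast hUA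
  -- (1) the two window identities from the semantic residuals, on the objective `Γ(incl h7) X`
  have hcertA := CARPolyWindow.windowIdentity_of_residPoly hΛ hz d dΛ f hf THA _ hHA TEA _ hEA o ho TXA μA νA κA
    capA κA' flA TGA ΛmA OA hGA EB γA wvA hshA gA hgA SYA CWA AVA hRA
  rw [hXA] at hcertA
  have hcertB := CARPolyWindow.windowIdentity_of_residPoly hΛ hz d dΛ f hf THB _ hHB TEB _ hEB o ho TXB μB νB κB
    capB κB' flB TGB ΛmB OB hGB EB γB wvB hshB gB hgB SYB CWB AVB hRB
  rw [hXB] at hcertB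
  -- (2) the charged words are charged (decided on the syntax)
  have hcwA' := CARPolyWindow.charged_of_hcw d sp hsp CWA hcwA
  have hcwB' := CARPolyWindow.charged_of_hcw d sp hsp CWB hcwB
  -- (3) the prices are the engine's `lowerConst`; the slopes are half the expect-row multiplier sums
  have hβA' : ((βA : ℚ) : ℝ) ≤ ((constCoeff RA : ℚ) : ℝ) - ∑ k ∈ (Finset.univ : Finset (Fin RA.length)), ‖resCoeff RA k‖ +
      (∑ σ : Fin 2, ((μA σ : ℚ) : ℝ)) * (((n₀ : ℚ) : ℝ) / 2 - ((νA : ℚ) : ℝ)) := by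
    rw [constCoeff_sub_sum_norm_resCoeff RA, Fin.sum_univ_two]
    have h2 : ((βA : ℚ) : ℝ) ≤ (((lowerConst RA + (μA 0 + μA 1) * (n₀ / 2 - νA) : ℚ)) : ℝ) := by exact_mod_cast hβA
    push_cast at h2
    linarith
  have hβB' : ((βB : ℚ) : ℝ) ≤ ((constCoeff RB : ℚ) : ℝ) - ∑ k ∈ (Finset.univ : Finset (Fin RB.length)), ‖resCoeff RB k‖ +
      (∑ σ : Fin 2, ((μB σ : ℚ) : ℝ)) * (((n₀ : ℚ) : ℝ) / 2 - ((νB : ℚ) : ℝ)) := by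
    rw [constCoeff_sub_sum_norm_resCoeff RB, Fin.sum_univ_two]
    have h2 : ((βB : ℚ) : ℝ) ≤ (((lowerConst RB + (μB 0 + μB 1) * (n₀ / 2 - νB) : ℚ)) : ℝ) := by exact_mod_cast hβB
    push_cast at h2
    linarith
  have hslA' : 2 * ((slA : ℚ) : ℝ) = ∑ σ : Fin 2, ((μA σ : ℚ) : ℝ) := by
    rw [Fin.sum_univ_two]; exact_mod_cast hslA.symm
  have hslB' : 2 * ((slB : ℚ) : ℝ) = ∑ σ : Fin 2, ((μB σ : ℚ) : ℝ) := by
    rw [Fin.sum_univ_two]; exact_mod_cast hslB.symm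
  -- (4) the identity-level pair theorem, with the SHARED eom words `B_k := termOp dΛ (EB.get k)`
  exact SquareTTPrimePinnedPairRowU.of_windowIdentities_wide hUr ((UB : ℚ) : ℝ) ((s : ℚ) : ℝ) n₀ h7 hΛ h8 h0 hz X
    (Finset.univ : Finset (Fin EB.length)) (fun k => termOp dΛ (EB.get k))
    (fun σ => ((μA σ : ℚ) : ℝ)) ((νA : ℚ) : ℝ) capA flA κA κA' hΛmA OA Finset.univ γA wvA hshA (fun l => termOp dΛ (SYA l))
    Finset.univ (fun j => (((CWA.get j).2 : ℚ) : ℂ)) (fun j => wmap d (CWA.get j).1) hcwA' Finset.univ (fun _ => (1 : ℝ))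
    (fun m' => termOp d (AVA.get m')) Finset.univ (resCoeff RA) (resWord d RA) hcertA hβA' hslA'
    (fun σ => ((μB σ : ℚ) : ℝ)) ((νB : ℚ) : ℝ) capB flB κB κB' hΛmB OB Finset.univ γB wvB hshB (fun l => termOp dΛ (SYB l))
    Finset.univ (fun j => (((CWB.get j).2 : ℚ) : ℂ)) (fun j => wmap d (CWB.get j).1) hcwB' Finset.univ (fun _ => (1 : ℝ))
    (fun m' => termOp d (AVB.get m')) Finset.univ (resCoeff RB) (resWord d RB) hcertB hβB' hslB'

end PolyWide

end Summit.Ventures.CertifiedManyBodySolver.Downfold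

end
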